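import Mathlib
import Literature.NumberTheory.LFunctions.Zhang2022.Section10Range1321MidExact
import Literature.NumberTheory.LFunctions.Zhang2022.Section8AbelProfiles
import Literature.NumberTheory.LFunctions.Zhang2022.Section3Lemma31
import HarnessLib

/-!
# Zhang (2022) §10, `Θ₁(𝐚₁₃,𝐚₂₁)`, middle range (`Z22:§10.u043`, first line): the per-`n` estimate

Topic `Literature/NumberTheory/LFunctions/Zhang2022` (Landau–Siegel audit tree; verdict-neutral).
Y. Zhang, *Discrete mean estimates and the Landau–Siegel zero*, arXiv:2211.02515v1 (2022)
[Zhang2022LandauSiegel], §10 p. 58 — **an unrefereed manuscript under adjudication; nothing here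
bears on its Theorems 1–2.** Companion of `Section10Range1321MidExact` for the edge
`Sj1321Mid.eq1043a_of : Lemma101 → Lemma84 → Typed.Sec10B.Eq1043a` (`Section10Range1321Mid`):
`norm_drWeight_div_le` (`|w(n/r,r)| ≤ [r sqfree]φ(r)⁻¹(n/φ(n))⁴/n`), the per-`n` bound
`norm_sum_divisors_le` (`|Σ_{r∣n} w·Δ| ≤ (n/φ(n))⁷n⁻¹(e₁(e₂ + 146Λ′) + Ae₂)/log P₁` from the
product estimate, `|Π(d,r)| ≤ (dr/φ(dr))²`, `Σ_{r∣n sqfree}φ(r)⁻¹ = n/φ(n)`), the sizes of the main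
values (`norm_frakgW_six_le`: `|𝔤_{j6}| ≤ 146`; `norm_mainV1_le`; `norm_derivL_one_le_cube`:
`|L′(1,χ)| ≤ 𝓛³` for `𝓛 ≥ 200`), and the window weights `Σ(n/φ(n))⁷/n` over the good range, the top
`T`-window and a single point (`weight_good_le`, `weight_top_le`, `weight_point_le`, from
`Section10RangeToolkit.sum_ratio_pow_div_le`).

## References

* Y. Zhang, arXiv:2211.02515v1 (2022), §10 p. 58; §8 Lemmas 8.3–8.4; §7 p. 33.
  [cite: Zhang2022LandauSiegel, §10 p. 58]
-/

noncomputable section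

open Complex Real Finset ComplexConjugate

namespace Literature.NumberTheory.LFunctions.Zhang2022.Sj1321Mid

open Skeleton Typed.Sec10B

variable (c' : ℝ) {D : ℕ}

/-- `P > 0`. [cite: Zhang2022LandauSiegel, §2 (2.6)] -/
private theorem bigP_pos'' (D : ℕ) : 0 < bigP D := Real.exp_pos _

/-- `log P = 𝓛⁹`. [cite: Zhang2022LandauSiegel, §2 (2.6)] -/
private theorem log_bigP' (D : ℕ) : Real.log (bigP D) = ell D ^ 9 := by rw [bigP, Real.log_exp]

/-- `log T = 𝓛^{1.1}`. [cite: Zhang2022LandauSiegel, §6 p. 30] -/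
private theorem log_bigT' (D : ℕ) : Real.log (bigT D) = ell D ^ (1.1 : ℝ) := by
  rw [Skeleton.bigT, Real.log_exp]

/-! ## §1. The weight -/

/-- **`|w(n/r,r)| ≤ [r squarefree]·φ(r)⁻¹·(n/φ(n))⁴/n`** for `r ∣ n`, `n ≥ 1`, where
`w(d,r) = |χ(d)||μχ(r)|λ₀ⱼ(dr)/(drφ(r))` (`Typed.Sec10B.drWeight`).
[cite: Zhang2022LandauSiegel, §10 p. 58] -/
theorem norm_drWeight_div_le (χ : DirichletCharacter ℂ D) (j : ℕ) {n : ℕ} (hn : n ≠ 0) {r : ℕ}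
    (hr : r ∈ n.divisors) :
    ‖drWeight c' χ j (n / r) r‖ ≤
      (if Squarefree r then 1 / (Nat.totient r : ℝ) else 0) * ((((n : ℝ) / Nat.totient n) ^ 4) / n) := by
  have hrn : n / r * r = n := Nat.div_mul_cancel (Nat.dvd_of_mem_divisors hr)
  have hn0 : (0 : ℝ) < n := by exact_mod_cast Nat.pos_of_ne_zero hn
  have hφr : (0 : ℝ) < Nat.totient r := by
    exact_mod_cast Nat.totient_pos.mpr (Nat.pos_of_mem_divisors hr)
  unfold drWeight
  rw [norm_chi_mul_norm_moebius_chi χ (n / r) r, hrn]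
  split_ifs with hsq
  · rw [norm_div, norm_mul, norm_mul, Complex.norm_real, norm_norm, Complex.norm_natCast,
      Complex.norm_natCast]
    have hχ : ‖χ (n : ZMod D)‖ ≤ 1 := DirichletCharacter.norm_le_one χ _
    have hlam := norm_lamZero_le c' D j hn
    rw [div_le_iff₀ (mul_pos hn0 hφr)]
    calc ‖χ (n : ZMod D)‖ * ‖lamZero c' D j n‖ ≤ 1 * (((n : ℝ) / Nat.totient n) ^ 4) :=
          mul_le_mul hχ hlam (norm_nonneg _) zero_le_one
      _ = 1 / (Nat.totient r : ℝ) * ((((n : ℝ) / Nat.totient n) ^ 4) / n) *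
            ((n : ℝ) * Nat.totient r) := by
          field_simp
  · simp

/-! ## §2. The per-`n` estimate -/

/-- The product estimate: `R·R′ − m·V = (R − m)(R′ − V) + (R − m)V + m(R′ − V)`.
[cite: Zhang2022LandauSiegel, §10 p. 58] -/
private theorem norm_mul_sub_mul_le {R R' m V : ℂ} {e₁ e₂ A B : ℝ} (h1 : ‖R - m‖ ≤ e₁)
    (h2 : ‖R' - V‖ ≤ e₂) (hA : ‖m‖ ≤ A) (hB : ‖V‖ ≤ B) :
    ‖R * R' - m * V‖ ≤ e₁ * e₂ + e₁ * B + A * e₂ := by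
  have e1 : 0 ≤ e₁ := (norm_nonneg _).trans h1
  have a0 : 0 ≤ A := (norm_nonneg _).trans hA
  have hsplit : R * R' - m * V = (R - m) * (R' - V) + (R - m) * V + m * (R' - V) := by ring
  rw [hsplit]
  calc ‖(R - m) * (R' - V) + (R - m) * V + m * (R' - V)‖
      ≤ ‖(R - m) * (R' - V)‖ + ‖(R - m) * V‖ + ‖m * (R' - V)‖ := norm_add₃_le
    _ ≤ e₁ * e₂ + e₁ * B + A * e₂ := by
        rw [norm_mul, norm_mul, norm_mul]
        gcongr

/-- **The per-`n` estimate.** Fix `n ≥ 1` in the middle range and `j`. Suppose the `m`-sum `M`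
(`= 𝔳₁ⱼ(n)`) is within `e₁` of a value `m₁` with `|m₁| ≤ A`; each `n`-sum is `(log P₁)⁻¹S(r)` with
`S(r)` within `e₂` of `L′(1,χ)Π(n/r,r)g`, `|g| ≤ 146`, `|L′(1,χ)| ≤ Λ′`. Then
`|Σ_{r∣n} w(n/r,r)(M·(n-sum) − m₁·L′Π(n/r,r)g/log P₁)| ≤ (n/φ(n))⁷n⁻¹(e₁(e₂ + 146Λ′) + Ae₂)/log P₁`.
[cite: Zhang2022LandauSiegel, §10 p. 58] -/
theorem norm_sum_divisors_le [NeZero D] (χ : DirichletCharacter ℂ D) (j : ℕ) {n : ℕ} (hn : n ≠ 0)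
    (M m₁ g : ℂ) (S : ℕ → ℂ) {e₁ e₂ A Λ' logP₁ : ℝ} (he₂ : 0 ≤ e₂) (hΛ : 0 ≤ Λ')
    (hlog : 0 < logP₁)
    (h1 : ‖M - m₁‖ ≤ e₁) (hA : ‖m₁‖ ≤ A) (hg : ‖g‖ ≤ 146) (hL' : ‖deriv χ.LFunction 1‖ ≤ Λ')
    (hN : ∀ r ∈ n.divisors, nSum21 c' χ j (n / r) r = (1 / (logP₁ : ℂ)) * S r)
    (h2 : ∀ r ∈ n.divisors, ‖S r - deriv χ.LFunction 1 * PiW χ (n / r) r * g‖ ≤ e₂) :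
    ‖∑ r ∈ n.divisors, drWeight c' χ j (n / r) r *
        (M * nSum21 c' χ j (n / r) r -
          m₁ * (deriv χ.LFunction 1 * PiW χ (n / r) r * g / (logP₁ : ℂ)))‖ ≤
      ((n : ℝ) / Nat.totient n) ^ 7 / n * ((e₁ * (e₂ + 146 * Λ') + A * e₂) / logP₁) := by
  have e1 : 0 ≤ e₁ := (norm_nonneg _).trans h1
  have a0 : 0 ≤ A := (norm_nonneg _).trans hA
  have hn0 : (0 : ℝ) < n := by exact_mod_cast Nat.pos_of_ne_zero hn
  set ρ : ℝ := (n : ℝ) / Nat.totient n with hρ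
  have hρ1 : 1 ≤ ρ := one_le_self_div_totient hn
  have hρ0 : 0 ≤ ρ := zero_le_one.trans hρ1
  set E : ℝ := e₁ * (e₂ + 146 * Λ') + A * e₂ with hE
  have hE0 : 0 ≤ E := by positivity
  have hterm : ∀ r ∈ n.divisors,
      ‖drWeight c' χ j (n / r) r * (M * nSum21 c' χ j (n / r) r -
          m₁ * (deriv χ.LFunction 1 * PiW χ (n / r) r * g / (logP₁ : ℂ)))‖ ≤
        (if Squarefree r then 1 / (Nat.totient r : ℝ) else 0) * (ρ ^ 6 / n * (E / logP₁)) := by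
    intro r hr
    have hr0 : r ≠ 0 := (Nat.pos_of_mem_divisors hr).ne'
    have hd0 : n / r ≠ 0 := (Nat.div_pos (Nat.divisor_le hr) (Nat.pos_of_mem_divisors hr)).ne'
    have hrn : n / r * r = n := Nat.div_mul_cancel (Nat.dvd_of_mem_divisors hr)
    have hdev : M * nSum21 c' χ j (n / r) r -
        m₁ * (deriv χ.LFunction 1 * PiW χ (n / r) r * g / (logP₁ : ℂ)) =
        (1 / (logP₁ : ℂ)) * (M * S r - m₁ * (deriv χ.LFunction 1 * PiW χ (n / r) r * g)) := by
      rw [hN r hr]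
      have : (logP₁ : ℂ) ≠ 0 := by exact_mod_cast hlog.ne'
      field_simp
    have hPi : ‖PiW χ (n / r) r‖ ≤ ρ ^ 2 := by
      have h := norm_PiW_le χ hd0 hr0
      rwa [hrn] at h
    have hV : ‖deriv χ.LFunction 1 * PiW χ (n / r) r * g‖ ≤ Λ' * ρ ^ 2 * 146 := by
      rw [norm_mul, norm_mul]
      gcongr
    have hprod := norm_mul_sub_mul_le h1 (h2 r hr) hA hV
    have hup : e₁ * e₂ + e₁ * (Λ' * ρ ^ 2 * 146) + A * e₂ ≤ ρ ^ 2 * E := by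
      have hρ2 : 1 ≤ ρ ^ 2 := one_le_pow₀ hρ1
      rw [hE]
      nlinarith [mul_nonneg e1 he₂, mul_nonneg a0 he₂, mul_nonneg e1 hΛ]
    have hw := norm_drWeight_div_le c' χ j hn hr
    rw [hdev, norm_mul, norm_mul, norm_div, norm_one, Complex.norm_real,
      Real.norm_of_nonneg hlog.le]
    calc ‖drWeight c' χ j (n / r) r‖ *
          (1 / logP₁ * ‖M * S r - m₁ * (deriv χ.LFunction 1 * PiW χ (n / r) r * g)‖)
        ≤ ((if Squarefree r then 1 / (Nat.totient r : ℝ) else 0) * (ρ ^ 4 / n)) *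
            (1 / logP₁ * (ρ ^ 2 * E)) := by
          refine mul_le_mul hw ?_ (by positivity) ?_
          · exact mul_le_mul_of_nonneg_left (hprod.trans hup) (by positivity)
          · split_ifs <;> positivity
      _ = (if Squarefree r then 1 / (Nat.totient r : ℝ) else 0) * (ρ ^ 6 / n * (E / logP₁)) := by
          ring
  calc ‖∑ r ∈ n.divisors, drWeight c' χ j (n / r) r * (M * nSum21 c' χ j (n / r) r -
          m₁ * (deriv χ.LFunction 1 * PiW χ (n / r) r * g / (logP₁ : ℂ)))‖
      ≤ ∑ r ∈ n.divisors, ‖drWeight c' χ j (n / r) r * (M * nSum21 c' χ j (n / r) r -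
          m₁ * (deriv χ.LFunction 1 * PiW χ (n / r) r * g / (logP₁ : ℂ)))‖ := norm_sum_le _ _
    _ ≤ ∑ r ∈ n.divisors,
          (if Squarefree r then 1 / (Nat.totient r : ℝ) else 0) * (ρ ^ 6 / n * (E / logP₁)) :=
        Finset.sum_le_sum hterm
    _ = (∑ r ∈ n.divisors with Squarefree r, 1 / (Nat.totient r : ℝ)) * (ρ ^ 6 / n * (E / logP₁)) := by
        rw [← Finset.sum_mul, Finset.sum_filter]
    _ = ρ ^ 7 / n * (E / logP₁) := by
        rw [sum_sqfree_divisors_inv_totient hn, ← hρ]; ring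

/-! ## §3. Sizes of the main values on the middle range -/

/-- `|𝔤_{j6}(x)| ≤ 146` for `1 ≤ x ≤ P^{0.004}` once `5|c′|α𝓛 ≤ 1` and `𝓛 > 0`
(`Section8AbelProfiles.norm_frakg_le` with `a = α`: `|β_k| ≤ 4α`, `|β₆| = 3α/2`, `α log x ≤ 0.004π`).
[cite: Zhang2022LandauSiegel, §8 Lemma 8.4] -/
theorem norm_frakgW_six_le (hL : 0 < ell D) (hc : 5 * |c'| * alpha D * ell D ≤ 1) (j : ℕ)
    {x : ℝ} (hx1 : 1 ≤ x) (hx : x ≤ bigP D ^ (0.004 : ℝ)) :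
    ‖frakgW c' D j 6 x‖ ≤ 146 := by
  have hα : 0 < alpha D := by
    rw [alpha, bigP, Real.log_exp]; positivity
  obtain ⟨hμlo, hμhi⟩ := Section8AbelProfiles.norm_betaMu_bounds hα.le 6
  have hlogx : 0 ≤ Real.log x := Real.log_nonneg hx1
  have hlogx' : Real.log x ≤ 0.004 * ell D ^ 9 := by
    have h := Real.log_le_log (by linarith) hx
    rw [Real.log_rpow (bigP_pos'' D), bigP, Real.log_exp] at h
    linarith
  have haL : alpha D * |Real.log x| ≤ 4 := by
    rw [abs_of_nonneg hlogx, alpha, bigP, Real.log_exp]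
    have h9 : 0 < ell D ^ 9 := pow_pos hL 9
    calc π / ell D ^ 9 * Real.log x ≤ π / ell D ^ 9 * (0.004 * ell D ^ 9) := by
          gcongr
      _ = 0.004 * π := by field_simp
      _ ≤ 4 := by nlinarith [Real.pi_lt_four]
  rw [frakgW]
  exact (Section8AbelProfiles.norm_frakg_le hα (Section8AbelProfiles.betaMu_re D 6) hμhi hμlo
    (Section8AbelProfiles.norm_betaJ_le c' hα.le hL.le hc _)
    (Section8AbelProfiles.norm_betaJ_le c' hα.le hL.le hc _) haL).1

/-- `|500L′(1,χ)/log P·(−1 − β_j log(n/P^{0.5}))| ≤ 1000|L′(1,χ)|𝓛⁻⁹` for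
`P^{0.5} ≤ n ≤ P^{0.502}` (`|β_j| ≤ 4α`, `α·0.002 log P = 0.002π`), once `5|c′|α𝓛 ≤ 1`.
[cite: Zhang2022LandauSiegel, §10 (10.3)] -/
theorem norm_mainV1_le [NeZero D] (χ : DirichletCharacter ℂ D) (hL : 0 < ell D)
    (hc : 5 * |c'| * alpha D * ell D ≤ 1) (j : ℕ) {y : ℝ} (hlo : bigP D ^ (0.5 : ℝ) ≤ y)
    (hhi : y ≤ bigP D ^ (0.502 : ℝ)) :
    ‖500 * deriv χ.LFunction 1 / Real.log (bigP D) *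
        (-1 - betaJ c' D j * (Real.log (y / bigP D ^ (0.5 : ℝ)) : ℂ))‖ ≤
      1000 * ‖deriv χ.LFunction 1‖ / ell D ^ 9 := by
  have hα : 0 < alpha D := by rw [alpha, bigP, Real.log_exp]; positivity
  have h9 : 0 < ell D ^ 9 := pow_pos hL 9
  have hP5 : 0 < bigP D ^ (0.5 : ℝ) := Real.rpow_pos_of_pos (Real.exp_pos _) _
  have hy : 0 < y := lt_of_lt_of_le hP5 hlo
  have hlog0 : 0 ≤ Real.log (y / bigP D ^ (0.5 : ℝ)) :=
    Real.log_nonneg ((one_le_div hP5).mpr hlo)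
  have hlog1 : Real.log (y / bigP D ^ (0.5 : ℝ)) ≤ 0.002 * ell D ^ 9 := by
    have h := Real.log_le_log hy hhi
    rw [Real.log_div hy.ne' hP5.ne']
    rw [Real.log_rpow (bigP_pos'' D)] at h ⊢
    rw [bigP, Real.log_exp] at h ⊢
    linarith
  have hβ : ‖betaJ c' D j‖ ≤ 4 * alpha D :=
    Section8AbelProfiles.norm_betaJ_le c' hα.le hL.le hc j
  have hfac : ‖(-1 : ℂ) - betaJ c' D j * (Real.log (y / bigP D ^ (0.5 : ℝ)) : ℂ)‖ ≤ 2 := by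
    calc ‖(-1 : ℂ) - betaJ c' D j * (Real.log (y / bigP D ^ (0.5 : ℝ)) : ℂ)‖
        ≤ ‖(-1 : ℂ)‖ + ‖betaJ c' D j * (Real.log (y / bigP D ^ (0.5 : ℝ)) : ℂ)‖ := norm_sub_le _ _
      _ = 1 + ‖betaJ c' D j‖ * Real.log (y / bigP D ^ (0.5 : ℝ)) := by
          rw [norm_neg, norm_one, norm_mul, Complex.norm_real, Real.norm_of_nonneg hlog0]
      _ ≤ 1 + 4 * alpha D * (0.002 * ell D ^ 9) := by gcongr
      _ = 1 + 0.008 * π := by rw [alpha, bigP, Real.log_exp]; field_simp; ring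
      _ ≤ 2 := by nlinarith [Real.pi_lt_four]
  have hlogP : Real.log (bigP D) = ell D ^ 9 := by rw [bigP, Real.log_exp]
  rw [norm_mul, norm_div, norm_mul, Complex.norm_real, hlogP, Real.norm_of_nonneg h9.le]
  have h500 : ‖(500 : ℂ)‖ = 500 := by norm_num
  rw [h500]
  calc 500 * ‖deriv χ.LFunction 1‖ / ell D ^ 9 *
        ‖(-1 : ℂ) - betaJ c' D j * (Real.log (y / bigP D ^ (0.5 : ℝ)) : ℂ)‖
      ≤ 500 * ‖deriv χ.LFunction 1‖ / ell D ^ 9 * 2 := by gcongr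
    _ = 1000 * ‖deriv χ.LFunction 1‖ / ell D ^ 9 := by ring

/-- `|L′(1,χ)| ≤ 𝓛³` for a primitive `χ (mod D)` with `𝓛 ≥ 200` (Cauchy's estimate
`|L′(1,χ)| ≤ 2e^{9/2}(1+𝓛)𝓛` of the tree's `Lemma31`, and `2e^{9/2} < 181`).
[cite: Zhang2022LandauSiegel, §2 (2.31)] -/
theorem norm_derivL_one_le_cube [NeZero D] (χ : DirichletCharacter ℂ D) (hp : χ.IsPrimitive)
    (hL : 200 ≤ ell D) : ‖deriv χ.LFunction 1‖ ≤ ell D ^ 3 := by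
  have hL3 : 3 ≤ Real.log D := by rw [← ell]; linarith
  have h := Lemma31.norm_deriv_LFunction_le_near_one χ hL3 hp (w := 1)
    (by rw [sub_self, norm_zero]; positivity)
  rw [← ell] at h
  have he : Real.exp (9 / 2) < 91 := by
    have h1 : Real.exp (9 / 2) = Real.exp 1 ^ 4 * Real.exp (1 / 2) := by
      rw [← Real.exp_nat_mul, ← Real.exp_add]; norm_num
    have h2 := Real.exp_one_lt_d9
    have hsq : Real.exp (1 / 2) ^ 2 = Real.exp 1 := by
      rw [← Real.exp_nat_mul]; norm_num
    have h3 : Real.exp (1 / 2) < 1.65 := by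
      nlinarith [Real.exp_pos (1 / 2 : ℝ)]
    have h4 : Real.exp 1 ^ 4 < 2.7182818286 ^ 4 :=
      pow_lt_pow_left₀ h2 (Real.exp_pos 1).le (by norm_num)
    rw [h1]
    calc Real.exp 1 ^ 4 * Real.exp (1 / 2) < 2.7182818286 ^ 4 * 1.65 :=
          mul_lt_mul'' h4 h3 (by positivity) (by positivity)
      _ < 91 := by norm_num
  have hL0 : 0 ≤ ell D := by linarith
  have hb : 0 ≤ ell D ^ 2 - 182 * ell D - 182 := by nlinarith
  calc ‖deriv χ.LFunction 1‖ ≤ 2 * Real.exp (9 / 2) * (1 + ell D) * ell D := h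
    _ ≤ 2 * 91 * (1 + ell D) * ell D := by gcongr
    _ ≤ ell D ^ 3 := by nlinarith [mul_nonneg hL0 hb]

/-! ## §4. Window weights `Σ (n/φ(n))⁷/n` over the three pieces of the middle range -/

/-- `T·P^{0.5} ≤ P^{0.502}` for `𝓛 ≥ 3`. [cite: Zhang2022LandauSiegel, §10 p. 58] -/
theorem bigT_mul_rpow_half_le (hL : 3 ≤ ell D) :
    bigT D * bigP D ^ (0.5 : ℝ) ≤ bigP D ^ (0.502 : ℝ) := by
  have hL1 : 1 ≤ ell D := by linarith
  have h7 : (3 : ℝ) ^ 7 ≤ ell D ^ 7 := pow_le_pow_left₀ (by norm_num) hL 7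
  have hP0 : 0 ≤ bigP D ^ (0.5 : ℝ) := Real.rpow_nonneg (bigP_pos'' D).le _
  calc bigT D * bigP D ^ (0.5 : ℝ) ≤ Real.exp (ell D ^ 2) * bigP D ^ (0.5 : ℝ) := by
        have := bigT_le_exp_sq (D := D) hL1
        gcongr
    _ = Real.exp (ell D ^ 2 + ell D ^ 9 * 0.5) := by rw [bigP_rpow_eq, ← Real.exp_add]
    _ ≤ Real.exp (ell D ^ 9 * 0.502) := Real.exp_le_exp.mpr (by nlinarith)
    _ = bigP D ^ (0.502 : ℝ) := (bigP_rpow_eq D _).symm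

/-- The good piece: `Σ_{⌊P^{0.5}⌋ < n ≤ ⌊P^{0.502}/T⌋} (n/φ(n))⁷/n ≤ e^{256}(2 + 𝓛⁹)` (`𝓛 ≥ 3`).
[cite: Zhang2022LandauSiegel, §10 p. 58] -/
theorem weight_good_le (hL : 3 ≤ ell D) :
    ∑ n ∈ Finset.Ioc ⌊bigP D ^ (0.5 : ℝ)⌋₊ ⌊bigP D ^ (0.502 : ℝ) / bigT D⌋₊,
        ((n : ℝ) / Nat.totient n) ^ 7 / n ≤ Real.exp 256 * (2 + ell D ^ 9) := by
  have hT1 : 1 ≤ bigT D := one_le_bigT D (by linarith)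
  have hT0 : 0 < bigT D := by linarith
  have hlo2 : (2 : ℝ) ≤ bigP D ^ (0.5 : ℝ) := by
    rw [bigP_rpow_eq]
    have h9 : (3 : ℝ) ^ 9 ≤ ell D ^ 9 := pow_le_pow_left₀ (by norm_num) hL 9
    have : (1 : ℝ) ≤ ell D ^ 9 * 0.5 := by nlinarith
    calc (2 : ℝ) ≤ 1 + 1 := by norm_num
      _ ≤ (ell D ^ 9 * 0.5) + 1 := by linarith
      _ ≤ Real.exp (ell D ^ 9 * 0.5) := Real.add_one_le_exp _
  have hhi : bigP D ^ (0.5 : ℝ) ≤ bigP D ^ (0.502 : ℝ) / bigT D := by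
    rw [le_div_iff₀ hT0, mul_comm]; exact bigT_mul_rpow_half_le hL
  have hY : 0 < ⌊bigP D ^ (0.5 : ℝ)⌋₊ := Nat.floor_pos.mpr (by linarith)
  have hYX : ⌊bigP D ^ (0.5 : ℝ)⌋₊ ≤ ⌊bigP D ^ (0.502 : ℝ) / bigT D⌋₊ := Nat.floor_mono hhi
  refine (sum_ratio_pow_div_le 7 hY hYX).trans ?_
  have hlogY : Real.log (bigP D ^ (0.5 : ℝ) / 2) ≤ Real.log (⌊bigP D ^ (0.5 : ℝ)⌋₊ : ℕ) := by
    refine Real.log_le_log (by linarith) ?_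
    have := Nat.sub_one_lt_floor (bigP D ^ (0.5 : ℝ))
    linarith
  have hlogX : Real.log (⌊bigP D ^ (0.502 : ℝ) / bigT D⌋₊ : ℕ) ≤
      Real.log (bigP D ^ (0.502 : ℝ)) := by
    refine Real.log_le_log (by exact_mod_cast lt_of_lt_of_le hY hYX) ?_
    have hP2 : 0 ≤ bigP D ^ (0.502 : ℝ) := Real.rpow_nonneg (bigP_pos'' D).le _
    exact (Nat.floor_le (div_nonneg hP2 hT0.le)).trans (div_le_self hP2 hT1)
  rw [Real.log_div (Real.rpow_pos_of_pos (bigP_pos'' D) _).ne' (by norm_num),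
    Real.log_rpow (bigP_pos'' D), log_bigP'] at hlogY
  rw [Real.log_rpow (bigP_pos'' D), log_bigP'] at hlogX
  have hlog2 : Real.log 2 ≤ 1 := by
    have := Real.log_two_lt_d9; linarith
  have h256 : (2 : ℝ) ^ (7 + 1) = 256 := by norm_num
  rw [h256]
  have h9 : 0 ≤ ell D ^ 9 := by positivity
  have hlin : 1 + Real.log (⌊bigP D ^ (0.502 : ℝ) / bigT D⌋₊ : ℕ) -
      Real.log (⌊bigP D ^ (0.5 : ℝ)⌋₊ : ℕ) ≤ 2 + ell D ^ 9 := by linarith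
  exact mul_le_mul_of_nonneg_left hlin (Real.exp_pos _).le

/-- The top window: `Σ_{⌊P^{0.502}/T⌋ < n ≤ ⌈P^{0.502}⌉} (n/φ(n))⁷/n ≤ e^{256}(3 + 𝓛²)` (`𝓛 ≥ 3`;
`log T = 𝓛^{1.1} ≤ 𝓛²`). [cite: Zhang2022LandauSiegel, §10 (10.5)] -/
theorem weight_top_le (hL : 3 ≤ ell D) :
    ∑ n ∈ Finset.Ioc ⌊bigP D ^ (0.502 : ℝ) / bigT D⌋₊ ⌈bigP D ^ (0.502 : ℝ)⌉₊,
        ((n : ℝ) / Nat.totient n) ^ 7 / n ≤ Real.exp 256 * (3 + ell D ^ 2) := by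
  have hL1 : 1 ≤ ell D := by linarith
  have hT1 : 1 ≤ bigT D := one_le_bigT D (by linarith)
  have hT0 : 0 < bigT D := by linarith
  have hP0 : 0 < bigP D ^ (0.502 : ℝ) := Real.rpow_pos_of_pos (bigP_pos'' D) _
  have hlo2 : (2 : ℝ) ≤ bigP D ^ (0.5 : ℝ) := by
    rw [bigP_rpow_eq]
    have h9 : (3 : ℝ) ^ 9 ≤ ell D ^ 9 := pow_le_pow_left₀ (by norm_num) hL 9
    have : (1 : ℝ) ≤ ell D ^ 9 * 0.5 := by nlinarith
    calc (2 : ℝ) ≤ 1 + 1 := by norm_num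
      _ ≤ (ell D ^ 9 * 0.5) + 1 := by linarith
      _ ≤ Real.exp (ell D ^ 9 * 0.5) := Real.add_one_le_exp _
  have hhi : bigP D ^ (0.5 : ℝ) ≤ bigP D ^ (0.502 : ℝ) / bigT D := by
    rw [le_div_iff₀ hT0, mul_comm]; exact bigT_mul_rpow_half_le hL
  have hY2 : (2 : ℝ) ≤ bigP D ^ (0.502 : ℝ) / bigT D := hlo2.trans hhi
  have hY : 0 < ⌊bigP D ^ (0.502 : ℝ) / bigT D⌋₊ := Nat.floor_pos.mpr (by linarith)
  have hYX : ⌊bigP D ^ (0.502 : ℝ) / bigT D⌋₊ ≤ ⌈bigP D ^ (0.502 : ℝ)⌉₊ := by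
    have h1 : (⌊bigP D ^ (0.502 : ℝ) / bigT D⌋₊ : ℝ) ≤ ⌈bigP D ^ (0.502 : ℝ)⌉₊ :=
      ((Nat.floor_le (by positivity)).trans (div_le_self hP0.le hT1)).trans (Nat.le_ceil _)
    exact_mod_cast h1
  refine (sum_ratio_pow_div_le 7 hY hYX).trans ?_
  have hlogY : Real.log (bigP D ^ (0.502 : ℝ) / bigT D / 2) ≤
      Real.log (⌊bigP D ^ (0.502 : ℝ) / bigT D⌋₊ : ℕ) := by
    refine Real.log_le_log (by positivity) ?_
    have := Nat.sub_one_lt_floor (bigP D ^ (0.502 : ℝ) / bigT D)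
    linarith
  have hlogX : Real.log (⌈bigP D ^ (0.502 : ℝ)⌉₊ : ℕ) ≤ Real.log (2 * bigP D ^ (0.502 : ℝ)) := by
    refine Real.log_le_log (by exact_mod_cast lt_of_lt_of_le hY hYX) ?_
    have := Nat.ceil_lt_add_one hP0.le
    have h1 : (1 : ℝ) ≤ bigP D ^ (0.502 : ℝ) := by
      have := hlo2.trans (hhi.trans (div_le_self hP0.le hT1)); linarith
    linarith
  rw [Real.log_div (div_pos hP0 hT0).ne' (by norm_num), Real.log_div hP0.ne' hT0.ne',
    log_bigT'] at hlogY
  rw [Real.log_mul (by norm_num) hP0.ne'] at hlogX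
  have hlog2 : Real.log 2 ≤ 1 := by
    have := Real.log_two_lt_d9; linarith
  have hrpow : ell D ^ (1.1 : ℝ) ≤ ell D ^ 2 := by
    have h := Real.rpow_le_rpow_of_exponent_le hL1 (show (1.1 : ℝ) ≤ 2 by norm_num)
    rwa [Real.rpow_two] at h
  have h256 : (2 : ℝ) ^ (7 + 1) = 256 := by norm_num
  rw [h256]
  have hlin : 1 + Real.log (⌈bigP D ^ (0.502 : ℝ)⌉₊ : ℕ) -
      Real.log (⌊bigP D ^ (0.502 : ℝ) / bigT D⌋₊ : ℕ) ≤ 3 + ell D ^ 2 := by linarith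
  exact mul_le_mul_of_nonneg_left hlin (Real.exp_pos _).le

/-- A single point: `Σ_{k−1 < n ≤ k} (n/φ(n))⁷/n ≤ 2e^{256}` for `k ≥ 2` (so the possible boundary
term `n = P^{0.5}` of the range costs `O(1)` weight). [cite: Zhang2022LandauSiegel, §10 (10.5)] -/
theorem weight_point_le {k : ℕ} (hk : 2 ≤ k) :
    ∑ n ∈ Finset.Ioc (k - 1) k, ((n : ℝ) / Nat.totient n) ^ 7 / n ≤ 2 * Real.exp 256 := by
  have hY : 0 < k - 1 := by omega
  have hYX : k - 1 ≤ k := Nat.sub_le k 1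
  refine (sum_ratio_pow_div_le 7 hY hYX).trans ?_
  have hk1 : ((k - 1 : ℕ) : ℝ) = (k : ℝ) - 1 := by
    rw [Nat.cast_sub (by omega)]; norm_num
  have hkR : (2 : ℝ) ≤ k := by exact_mod_cast hk
  have hlog : Real.log (k : ℝ) - Real.log ((k - 1 : ℕ) : ℝ) ≤ Real.log 2 := by
    rw [hk1, ← Real.log_div (by linarith) (by linarith)]
    refine Real.log_le_log (div_pos (by linarith) (by linarith)) ?_
    rw [div_le_iff₀ (by linarith)]; linarith
  have hlog2 : Real.log 2 ≤ 1 := by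
    have := Real.log_two_lt_d9; linarith
  have h256 : (2 : ℝ) ^ (7 + 1) = 256 := by norm_num
  rw [h256]
  have hlin : 1 + Real.log (k : ℝ) - Real.log ((k - 1 : ℕ) : ℝ) ≤ 2 := by linarith
  calc Real.exp 256 * (1 + Real.log (k : ℝ) - Real.log ((k - 1 : ℕ) : ℝ))
      ≤ Real.exp 256 * 2 := mul_le_mul_of_nonneg_left hlin (Real.exp_pos _).le
    _ = 2 * Real.exp 256 := by ring

end Literature.NumberTheory.LFunctions.Zhang2022.Sj1321Mid
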